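/- LEAD seat `ym-line-cbag-p1` (prover-ym-line-cbag-p1-g29-0), LINE 7 `GlueballBandRecursion`, item ⟨stmt-QuantumFields-22957⟩:
the VOLUME-COMPARISON statement for the cold thermal trace excess — the one estimate to which the route's closes-target, the IR cell's
strong-coupling rung `Cruxes.IR.ColdPurityBridge.ColdDoublingRecursionStrongCoupling`, reduces by SAME-VOLUME SQUARING (proved in
`Theorems/GlueballBandRecursionRungOfVolumeComparison.lean`), together with its small-coupling (`∃ β₁`) variants.  Definitions only
(route-posited objects, reviewed); route-independent (no `Theses` import). -/
import Summits.QuantumFields.YangMills.Theorems.BalabanLadderIRColdPurityBridgeRungs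

/-!
# Route `GlueballBandRecursion`: the cold trace excess is extensive in the spatial volume (volume comparison at fixed cold time)

Write `x_t(N) := traceExcess r.ρ β N t = Z_β(N³ × t)/λ₊(β,N)^t − 1 = Σ_{i ≠ i₀} (λᵢ/λ₊)^t` for the thermal trace excess of the spatial torus
`(ℤ/N)³` at Euclidean period `t`, and `δᶜ_β(L) = 1 − Z_β(L³ × 2⌊L/4⌋)/Z_β(L³ × ⌊L/4⌋)²` for the cold period-doubling defect
(`Cruxes.IR.ColdPurityBridge.coldDefect`).  The rung `ColdDoublingRecursionStrongCoupling` asks for `δᶜ_β(L') ≤ C·δᶜ_β(L)²` for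
`L' ∈ [2L, 4L]`, uniformly on the strong-coupling window.  Two of its three ingredients are FREE (spectral positivity, proved in the companion
file): at fixed spatial volume `x_{t'} ≤ x_t` for `t' ≥ t` and `x_{2t} ≤ x_t²` (the ratios `λᵢ/λ₊` lie in `[0, 1]`), so with the tree's two-sided
`2x/(1+x)² ≤ δᶜ ≤ 2x` the rung follows from the third ingredient ALONE, typed here:

* `TraceExcessVolumeComparison` — **the cold trace excess is extensive in the spatial volume up to a constant**: `K`, `L₀` uniform on
  `0 ≤ β ≤ strongCouplingRadius r.ρ` with `x_{⌊L/4⌋}(L') ≤ K · x_{⌊L/4⌋}(L)` for `L₀ ≤ L`, `2L ≤ L' ≤ 4L` (same cold time, larger spatial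
  torus).  Physically `x_t(N) ≈ 3n·N³·q(β)^t` (a dilute gas of one-plaquette excitations, `q ≈ u(β)⁴`), so `K ≈ 64`; the statement carries NO
  band structure, NO symbol, NO isolation and NO anchor — it is strictly weaker than the line's `Band.IsolatedBandFrame` /
  `Band.EffectiveBlochSymbolFamily`, and it is what every proof of the rung must deliver anyway.
* `TraceExcessVolumeComparisonSmallCoupling`, `ColdDoublingRecursionSmallCoupling` — the same two statements on a window `0 ≤ β ≤ β₁` with
  `β₁ = β₁(G, r) > 0` EXISTENTIAL instead of the explicit `strongCouplingRadius r.ρ` of module XII.  Recorded because the honest reach of the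
  tree's strong-coupling tools is an explicit-but-smaller window: a proof of the volume comparison needs a volume-uniform FLOOR
  `x_t(N) ≥ (c₁β⁴)^t` (in tree on an engine window `β ≤ β_F ≤ r_ρ`: `Cruxes.IR.VolumeMonotone.traceExcess_floor_strongCoupling_uniform`,
  compact simple Lie `G`, odd sides) against a CLOSEDNESS-aware finite-size bound on the thermal free-energy density
  `(log Z_β(N³×t) − t log λ₊(β,N))/N³` (volume-spanning closed plaquette families have `≥ 4(N−1)` members, so the volume dependence is
  `O(β^{4N−4})`, below the floor `β^{4⌊L/4⌋} ≥ β^{L}` with room; the tree's connectivity-only count `≈ N − 1` misses by one plaquette), and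
  the crude Kotecký–Preiss constants do not certify `β₁ ≥ strongCouplingRadius r.ρ` for every representation.

HONEST FRAMING.  Definitions; nothing is proved here — not the volume comparison, not the rung (RECORD-type, strong coupling, group-blind),
and a fortiori not the Yang–Mills mass gap / the summit `YangMills`.
-/

set_option autoImplicit false

noncomputable section

open Literature.MathematicalPhysics.QuantumFieldTheory
open Literature.MathematicalPhysics.QuantumFieldTheory.Balaban1983to89.Missing (strongCouplingRadius)
open Summit.QuantumFields.YangMills.Cruxes.IR.ColdPurityBridge (coldDefect)

namespace Summit.QuantumFields.YangMills.Theorems.GlueballBandRecursion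

/-- **Volume comparison of the cold trace excess on the strong-coupling window.**  For every compact `G` and faithful unitary lattice
representation `r` there are `K ≥ 0` and `L₀` such that for all `0 ≤ β ≤ strongCouplingRadius r.ρ`, all `L ≥ L₀` with cold time
`⌊L/4⌋ = m + 2` and all `2L ≤ L' ≤ 4L`: `traceExcess r.ρ β L' (m+2) ≤ K · traceExcess r.ρ β L (m+2)` — the thermal trace excess at FIXED
cold Euclidean period grows at most by a constant factor when the spatial torus is enlarged from `L³` to `L'³` (extensivity of the dilute
glueball gas; physically `K ≈ (L'/L)³ ≤ 64`).  With same-volume squaring it implies `ColdDoublingRecursionStrongCoupling`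
(`coldDoublingRecursionStrongCoupling_of_volumeComparison`).  Why it might fail as typed: only through the explicit window — the extensivity
itself is the content of any convergent strong-coupling expansion, but the tree's constants reach a smaller `β₁(r)` (see the `SmallCoupling`
variant). -/
def TraceExcessVolumeComparison : Prop :=
  ∀ (G : Type) [Group G] [TopologicalSpace G] [IsTopologicalGroup G] [CompactSpace G],
    letI : MeasurableSpace G := borel G
    haveI : BorelSpace G := ⟨rfl⟩
    ∀ r : LatticeRep G, ∃ K : ℝ, 0 ≤ K ∧ ∃ L₀ : ℕ, ∀ β : ℝ, 0 ≤ β → β ≤ strongCouplingRadius r.ρ →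
      ∀ (L : ℕ) [NeZero L] (L' : ℕ) [NeZero L'] (m : ℕ), L / 4 = m + 2 → L₀ ≤ L → 2 * L ≤ L' → L' ≤ 4 * L →
        traceExcess r.ρ β L' (m + 2) ≤ K * traceExcess r.ρ β L (m + 2)

/-- **Volume comparison of the cold trace excess at SMALL coupling** (`∃ β₁` form of `TraceExcessVolumeComparison`): per `(G, r)` a window
`0 < β₁` and `K ≥ 0`, `L₀` with `traceExcess r.ρ β L' (m+2) ≤ K · traceExcess r.ρ β L (m+2)` for `0 ≤ β ≤ β₁`, `L₀ ≤ L`, `⌊L/4⌋ = m + 2`,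
`2L ≤ L' ≤ 4L`.  This is the form the tree's tools can reach (floor `(c₁β⁴)^t ≤ x_t` on an engine window plus a closedness-aware finite-size
bound of order `β^{4N−4}` on the thermal free-energy density); it implies `ColdDoublingRecursionSmallCoupling`
(`coldDoublingRecursionSmallCoupling_of_volumeComparison`). -/
def TraceExcessVolumeComparisonSmallCoupling : Prop :=
  ∀ (G : Type) [Group G] [TopologicalSpace G] [IsTopologicalGroup G] [CompactSpace G],
    letI : MeasurableSpace G := borel G
    haveI : BorelSpace G := ⟨rfl⟩
    ∀ r : LatticeRep G, ∃ β₁ : ℝ, 0 < β₁ ∧ ∃ K : ℝ, 0 ≤ K ∧ ∃ L₀ : ℕ, ∀ β : ℝ, 0 ≤ β → β ≤ β₁ →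
      ∀ (L : ℕ) [NeZero L] (L' : ℕ) [NeZero L'] (m : ℕ), L / 4 = m + 2 → L₀ ≤ L → 2 * L ≤ L' → L' ≤ 4 * L →
        traceExcess r.ρ β L' (m + 2) ≤ K * traceExcess r.ρ β L (m + 2)

/-- **The cold dyadic contraction at SMALL coupling** (`∃ β₁` form of the IR cell's rung `ColdDoublingRecursionStrongCoupling`): for every
compact `G` and `r` there are `β₁ > 0`, `C > 0`, `L₀` with `δᶜ_β(L') ≤ C · δᶜ_β(L)²` for all `0 ≤ β ≤ β₁`, `L ≥ L₀`, `L' ∈ [2L, 4L]`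
(`δᶜ = coldDefect`).  Weaker than the rung only through the window (`coldDoublingRecursionSmallCoupling_of_strongCoupling`); it is what a
strong-coupling expansion with crude constants can certify. -/
def ColdDoublingRecursionSmallCoupling : Prop :=
  ∀ (G : Type) [Group G] [TopologicalSpace G] [IsTopologicalGroup G] [CompactSpace G],
    letI : MeasurableSpace G := borel G
    haveI : BorelSpace G := ⟨rfl⟩
    ∀ r : LatticeRep G, ∃ β₁ : ℝ, 0 < β₁ ∧ ∃ C : ℝ, 0 < C ∧ ∃ L₀ : ℕ, ∀ β : ℝ, 0 ≤ β → β ≤ β₁ →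
      ∀ L : ℕ, L₀ ≤ L → ∀ L' : ℕ, 2 * L ≤ L' → L' ≤ 4 * L →
        coldDefect r.ρ β L' ≤ C * coldDefect r.ρ β L ^ 2

end Summit.QuantumFields.YangMills.Theorems.GlueballBandRecursion

end
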